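import Mathlib.Analysis.SpecialFunctions.Log.Base
import Mathlib.Analysis.SpecialFunctions.Pow.Real
import Literature.Computability.AlgebraicComplexity.RelativeExponent
import Literature.Computability.AlgebraicComplexity.BorderRankCW
import HarnessLib

/-!
# Barrier: irreversibility of the intermediate tensor (Christandl–Vrana–Zuiddam 2021)

Topic `Literature/Barriers/MatrixMultiplication` (D-0021 barrier catalogue for the summit
`MatrixMultiplication`, `ω(ℂ) = 2`, `Summits/MatrixMultiplication/MatrixMultiplication/Statement.lean`).

Source: M. Christandl, P. Vrana, J. Zuiddam, *Barriers for fast matrix multiplication from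
irreversibility*, Theory of Computing 17 (2021), art. 2, 1–32 (CCC 2019) = arXiv:1812.06952.
**Numbering below is that of arXiv v1/v2** (the held copy, page-checked with `lit read`:
Def. 2 and Prop. 3 p. 5, Def. 4 / Prop. 5 / Def. 6 p. 5, §2.4 pp. 5–6, Thm. 9 and Thm. 10 p. 7,
Thm. 19 p. 9, Rem. 20 and Thm. 22 p. 10, §4.3 pp. 10–11; arXiv v3/v4 and the ToC version renumber:
e.g. v4 Def. 4 / Prop. 5 / Def. 6 / Prop. 7 / Prop. 9, ToC Def. 2.4 / Prop. 2.5 — review of p6933).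

## Catalogue entry

The D-0021 structured block (`technique_class / blocks / because / evasions_known / scope_caveats /
status`) is in the docstring of the catalogue declaration `IrreversibilityBarrier` at the end of this
file (the gate indexes declaration docstrings, not module docstrings).

## Content

* `bigCwTensor K q = CW_q = e_{0,0,q+1} + e_{0,q+1,0} + e_{q+1,0,0} + Σ_{i=1}^q (e_{0,i,i} + e_{i,0,i} + e_{i,i,0})
  ∈ (K^{q+2})^{⊗3}` (CVZ §1.4 and Thm. 22; the small `cw_q` is the tree's `cwTensor K q`,
  `BorderRankCW.lean`).
* The general notions — `restrictionCost`, the **relative exponent**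
  `relativeExponent t s = ω(t,s) = lim_n n⁻¹ · min {m | t^{⊗m} ≥ s^{⊗n}}` (CVZ Def. 2, formalised as
  the infimum over `n ≥ 1`), `irreversibility t = i(t) = ω(⟨2⟩,t) · ω(t,⟨2⟩)` (Def. 4) and the
  monomial variants of §2.4 (`IsGenSubperm`, `TensorMonRestrictsTo` = `t ≥_M s`,
  `monRestrictionCost`, `monRelativeExponent` = `ω_M(t,s)`, `monIrreversibility` = `i_M(t)`) — are
  imported from `Literature/Computability/AlgebraicComplexity/RelativeExponent.lean` (split off at
  the request of the review of p6795); `≥` is the tree's `TensorRestrictsTo`, powers are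
  `kroneckerPow`, `⟨2⟩ = unitTensor K 2` (`AsymptoticSpectrum.lean`). The monomial facts
  `CVZ2021_prop7` (`i_M ≥ i`), `CVZ2021_thm13`, `CVZ2021_thm14` are the form of the barrier that
  applies to the group-theoretic method (`⟨G⟩ ≥_M ⟨a,b,c⟩`, §4.3).
* Named facts (statements only, `def … : Prop`): `CVZ2021_prop5` (`i(t) ≥ 1`), `CVZ2021_thm9`,
  `CVZ2021_thm10`, `CVZ2021_prop7`, `CVZ2021_thm13`, `CVZ2021_thm14`,
  `CVZ2021_relativeExponent_unit` (§2.2: `ω(⟨2⟩,t) = log₂ R̃(t)`,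
  `ω(t,⟨2⟩) = 1/log₂ Q̃(t)`), `CVZ2021_thm19` (small `cw_q`), `CVZ2021_thm22` (big `CW_q`, with the
  printed entropy function `cvzEntropy q x = f_q(x)` and maximiser `cvzArgmax q`), and
  `BCS1997_ex1524_4` (`R̃(⟨2,2,2⟩) = 2^ω`, the identification of CVZ's `ω := log₂ R̃(⟨2,2,2⟩)`
  with the tree's `omega K`, Bläser Def. 5.1).
* Proved: unfolding/entry lemmas for `CW_q`, `matMulTensor_two_ne_triad`,
  `bigCwTensor_ne_triad`, `cwTensor_ne_triad` (Assumption 1 for `⟨2,2,2⟩`, `CW_q`, `cw_q`), and the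
  corollaries `CVZ2021_thm9.two_lt` ("an irreversible intermediate tensor cannot certify `ω = 2`"),
  `CVZ2021_thm10.two_irr_le`, `CVZ2021_thm22.bigCw_barrier`, `CVZ2021_thm19.cw_barrier`.
* Catalogue entry `IrreversibilityBarrier : Prop` (conjunction of Thm. 9, 13, 19, 22) carrying the
  D-0021 structured block, with projections.

## Design choices and wording risks

* CVZ, Assumption 1 (p. 5): "we will from now on … only consider tensors that are not of the form
  `u ⊗ v ⊗ w`". Every fact below carries this hypothesis as `∀ w u v, t ≠ triad w u v` (this also
  excludes `t = 0 = triad 0 0 0`).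
* CVZ work over "some fixed but arbitrary field `F`" (§2.1); the facts quantify over all fields
  `K : Type` and index types in `Type` (all finite formats up to reindexing, as in
  `AsymptoticSpectrum.lean`).
* **`lim` versus `sup`/`inf` in Def. 2.** CVZ define `ω(t,s)` as the LIMIT of
  `n⁻¹ f(n)`, `f(n) := min {m | t^{⊗m} ≥ s^{⊗n}}`, and add "= sup_n n⁻¹ f(n) … by Fekete's lemma".
  Since restrictions multiply under `⊗` (`t^{⊗m₁} ≥ s^{⊗n₁}`, `t^{⊗m₂} ≥ s^{⊗n₂}` give
  `t^{⊗(m₁+m₂)} ≥ s^{⊗(n₁+n₂)}`), `f` is subadditive and Fekete's lemma identifies the limit with the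
  INFIMUM `inf_n n⁻¹ f(n)`; this is also what the paper's identities `ω(⟨2⟩,t) = log₂ R̃(t)`
  (`R̃ = inf_n R(t^{⊗n})^{1/n}`) and `ω(t,t) = 1` require (for `t = ⟨2,2,2⟩`, `f(1) = ⌈log₂ 7⌉ = 3`
  exceeds the limit `ω`). We therefore formalise the printed limit as `⨅ n, f(n+1)/(n+1)`; nothing
  below depends on reading it as a supremum.
* **Junk values and the finiteness hypotheses.** `restrictionCost`/`monRestrictionCost` are
  `Nat.sInf` (`0` on the empty set), so where the paper's `min ∅ = ∞` makes a relative exponent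
  `+∞` the Lean value is the junk `0`. Which side of each fact the junk can hit:
  - `CVZ2021_prop5` (`1 ≤ i(t)`) and `CVZ2021_prop7` (`i(t) ≤ i_M(t)`): the junk hits the side that
    must be LARGE (`i(t)`, resp. `i_M(t)`, via `ω(t,⟨2⟩)`/`ω_M(t,⟨2⟩)`, e.g. for `e₀ ⊗ I₂` with
    `Q̃ = 1`, not excluded by Assumption 1). Vendored with the explicit hypothesis
    `∃ m, t^{⊗m} ≥ ⟨2⟩` (resp. `≥_M`), i.e. `Q̃(t) > 1` (resp. `Q̃_M(t) > 1`); in print the excluded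
    cases read `∞ ≥ 1`, `∞ ≥ i(t)` (review of p6505).
  - `CVZ2021_thm13`, `CVZ2021_thm14` (monomial barrier): the junk hits the RIGHT-hand side
    `ω_M(t,⟨2,2,2⟩)` (resp. `ω_M(t, ⟨2⟩^{⊗α} ⊗ ⟨2,2,2⟩^{⊗β})`) while the left side `i_M(t)` can be
    genuine — a monomial restriction of a power of a unit-like tensor has at most one nonzero entry
    per slice, so `⟨2,2,2⟩` need not be reachable even when `⟨2⟩` is (review of p6795: `t = ⟨2⟩`
    refutes the hypothesis-free forms). Vendored with the explicit hypothesis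
    `∃ m, t^{⊗m} ≥_M ⟨2,2,2⟩`, under which (monomial restrictions compose and multiply under `⊗`,
    `⟨2,2,2⟩ ≥_M ⟨2⟩`) all sets defining `ω_M(t,⟨2,2,2⟩)`, `ω_M(t,⟨2⟩)`,
    `ω_M(t,⟨2⟩^{⊗α} ⊗ ⟨2,2,2⟩^{⊗β})` are nonempty; without it the printed right-hand sides are `+∞`
    and the printed statements are vacuous, so nothing printed is lost.
  - `CVZ2021_thm9`, `CVZ2021_thm10` (plain restriction): if some power of `t` restricts to `⟨2⟩`
    then `t^{⊗3m} ≥ ⟨2⟩^{⊗3} ≥ ⟨2,2,2⟩` and every defining set on both sides is nonempty; if not,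
    `ω(t,⟨2⟩) = 0` forces the left side `i(t) = 0 ≤` right side. Not affected; vendored with
    Assumption 1 only. Likewise `CVZ2021_relativeExponent_unit` (`1/log₂ 1 = 0` matches the junk)
    and `CVZ2021_thm19/22` (lower bounds on genuine products for `cw_q`, `CW_q`).
* Thm. 10 divides by `β ∈ ℕ`; the vendored statement adds `0 < β` (weaker than print, never
  stronger). Thm. 19/22 are vendored for `q ≥ 1` (`cw_0 = 0` is excluded by Assumption 1; the
  paper's tables start at `q = 2`, resp. `q = 1`).
* CVZ define `ω := log₂ R̃(⟨2,2,2⟩)` (§2.1); the tree's `omega K` is Bläser's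
  `inf {β | R(⟨n,n,n⟩) = O(n^β)}`. Their equality is BCS 1997, Ex. 15.24(4), vendored as the named
  fact `BCS1997_ex1524_4`; with `CVZ2021_relativeExponent_unit` it yields
  `ω(⟨2⟩, ⟨2,2,2⟩) = omega K` (`relativeExponent_unit_matMul_eq_omega`, proved from the two facts;
  `⟨2,2,2⟩` satisfies Assumption 1 by `matMulTensor_two_ne_triad`).
* Not vendored here: Cor. 11 / Cor. 15 (need the cyclic symmetrisation `cyc(t)` with real
  powers of tensors), Prop. 16–18 (mechanism; the support/quantum functionals live in
  `QuantumFunctionals.lean`), and the monomial-DEGENERATION variant mentioned in §2.4.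
-/

noncomputable section

open scoped BigOperators

namespace Literature.Barriers.MatrixMultiplication

universe u

/-! ## The big Coppersmith–Winograd tensor -/

section BigCW

variable (K : Type u) [CommSemiring K]

/-- **The big Coppersmith–Winograd tensor**
`CW_q = e_{0,0,q+1} + e_{0,q+1,0} + e_{q+1,0,0} + Σ_{i=1}^q (e_{0,i,i} + e_{i,0,i} + e_{i,i,0}) ∈ (K^{q+2})^{⊗3}`
(CVZ §1.4, Thm. 22): on `Fin (q+2)` (index `q+1 = Fin.last (q+1)`) the entry at `(a,b,c)` is `1`
exactly at the `3q + 3` listed positions and `0` elsewhere.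
[cite: ChristandlVranaZuiddam2021, Thm. 22] -/
def bigCwTensor (q : ℕ) : Fin (q + 2) → Fin (q + 2) → Fin (q + 2) → K :=
  fun a b c =>
    if (a = 0 ∧ b = c ∧ b ≠ 0 ∧ b ≠ Fin.last (q + 1)) ∨
        (b = 0 ∧ a = c ∧ a ≠ 0 ∧ a ≠ Fin.last (q + 1)) ∨
        (c = 0 ∧ a = b ∧ a ≠ 0 ∧ a ≠ Fin.last (q + 1)) ∨
        (a = 0 ∧ b = 0 ∧ c = Fin.last (q + 1)) ∨
        (a = 0 ∧ b = Fin.last (q + 1) ∧ c = 0) ∨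
        (a = Fin.last (q + 1) ∧ b = 0 ∧ c = 0) then 1 else 0

/-- Entries of `CW_q`. [cite: ChristandlVranaZuiddam2021, Thm. 22] -/
theorem bigCwTensor_apply (q : ℕ) (a b c : Fin (q + 2)) :
    bigCwTensor K q a b c =
      if (a = 0 ∧ b = c ∧ b ≠ 0 ∧ b ≠ Fin.last (q + 1)) ∨
          (b = 0 ∧ a = c ∧ a ≠ 0 ∧ a ≠ Fin.last (q + 1)) ∨
          (c = 0 ∧ a = b ∧ a ≠ 0 ∧ a ≠ Fin.last (q + 1)) ∨
          (a = 0 ∧ b = 0 ∧ c = Fin.last (q + 1)) ∨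
          (a = 0 ∧ b = Fin.last (q + 1) ∧ c = 0) ∨
          (a = Fin.last (q + 1) ∧ b = 0 ∧ c = 0) then 1 else 0 :=
  rfl

/-- The corner term `e_{0,0,q+1}` of `CW_q`. [cite: ChristandlVranaZuiddam2021, Thm. 22] -/
theorem bigCwTensor_corner (q : ℕ) : bigCwTensor K q 0 0 (Fin.last (q + 1)) = 1 := by
  simp [bigCwTensor]

/-- The middle terms `e_{0,i,i}`, `1 ≤ i ≤ q`, of `CW_q`. [cite: ChristandlVranaZuiddam2021, Thm. 22] -/
theorem bigCwTensor_middle (q : ℕ) {i : Fin (q + 2)} (h0 : i ≠ 0) (hl : i ≠ Fin.last (q + 1)) :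
    bigCwTensor K q 0 i i = 1 := by
  simp [bigCwTensor, h0, hl]

/-- `CW_q` vanishes at `(0,0,0)` (no term `e_{0,0,0}`). [cite: ChristandlVranaZuiddam2021, Thm. 22] -/
theorem bigCwTensor_zero (q : ℕ) : bigCwTensor K q 0 0 0 = 0 := by
  have h : (Fin.last (q + 1) : Fin (q + 2)) ≠ 0 := by
    simp [Fin.ext_iff]
  simp [bigCwTensor, h.symm]

end BigCW

/-! ## Named facts: the irreversibility barrier (CVZ Prop. 5, 7, Thm. 9, 10, 13, 14, §2.2) -/

section Facts

/-- **CVZ 2021, Proposition 5**: `i(t) ≥ 1` for every 3-tensor `t` over a field which is not of the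
form `u ⊗ v ⊗ w` (Assumption 1); vendored under the explicit finiteness hypothesis "some power of `t`
restricts to `⟨2⟩`" (`Q̃(t) > 1`, i.e. `ω(t,⟨2⟩) < ∞`; in print the remaining cases read `∞ ≥ 1`),
see the module docstring. [cite: ChristandlVranaZuiddam2021, Prop. 5] -/
def CVZ2021_prop5 : Prop :=
  ∀ (K : Type) [Field K] {ι κ μ : Type} [Fintype ι] [Fintype κ] [Fintype μ]
    (t : ι → κ → μ → K), (∀ w u v, t ≠ Literature.Computability.AlgebraicComplexity.triad w u v) →
      (∃ m : ℕ, Literature.Computability.AlgebraicComplexity.TensorRestrictsTo (Literature.Computability.AlgebraicComplexity.kroneckerPow t m) (Literature.Computability.AlgebraicComplexity.unitTensor K 2)) → 1 ≤ Literature.Computability.AlgebraicComplexity.irreversibility t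

/-- **CVZ 2021, Theorem 9 (the irreversibility barrier).** For any tensor `t` (over any field, not of
the form `u ⊗ v ⊗ w`): `ω(⟨2⟩, t) · ω(t, ⟨2,2,2⟩) ≥ 2 · i(t)`. Since every method of the technique
class certifies exactly `ω ≤ ω(⟨2⟩, t) · ω(t, ⟨2,2,2⟩)` (§3.1, by the triangle inequality and
`ω(⟨2⟩, ⟨2,2,2⟩) = ω`), "one cannot prove `ω = 2` via any fixed irreversible intermediate tensor".
[cite: ChristandlVranaZuiddam2021, Thm. 9] -/
def CVZ2021_thm9 : Prop :=
  ∀ (K : Type) [Field K] {ι κ μ : Type} [Fintype ι] [Fintype κ] [Fintype μ]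
    (t : ι → κ → μ → K), (∀ w u v, t ≠ Literature.Computability.AlgebraicComplexity.triad w u v) →
      2 * Literature.Computability.AlgebraicComplexity.irreversibility t ≤
        Literature.Computability.AlgebraicComplexity.relativeExponent (Literature.Computability.AlgebraicComplexity.unitTensor K 2) t * Literature.Computability.AlgebraicComplexity.relativeExponent t (Literature.Computability.AlgebraicComplexity.matMulTensor K 2 2 2)

/-- **CVZ 2021, Theorem 10** (more structure: Schönhage's `τ`-theorem as the last step). For any
tensor `t` and `α, β ∈ ℕ` (here `β > 0`, the printed statement divides by `β`):
`(ω(⟨2⟩,t) · ω(t, ⟨2⟩^{⊗α} ⊗ ⟨2,2,2⟩^{⊗β}) − α)/β ≥ 2 i(t) + (α/β)(i(t) − 1)` (`≥ 2 i(t)` by Prop. 5).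
[cite: ChristandlVranaZuiddam2021, Thm. 10] -/
def CVZ2021_thm10 : Prop :=
  ∀ (K : Type) [Field K] {ι κ μ : Type} [Fintype ι] [Fintype κ] [Fintype μ]
    (t : ι → κ → μ → K), (∀ w u v, t ≠ Literature.Computability.AlgebraicComplexity.triad w u v) → ∀ α β : ℕ, 0 < β →
      2 * Literature.Computability.AlgebraicComplexity.irreversibility t + (α / β : ℝ) * (Literature.Computability.AlgebraicComplexity.irreversibility t - 1) ≤
        (Literature.Computability.AlgebraicComplexity.relativeExponent (Literature.Computability.AlgebraicComplexity.unitTensor K 2) t *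
            Literature.Computability.AlgebraicComplexity.relativeExponent t
              (Literature.Computability.AlgebraicComplexity.kroneckerTensor (Literature.Computability.AlgebraicComplexity.kroneckerPow (Literature.Computability.AlgebraicComplexity.unitTensor K 2) α)
                (Literature.Computability.AlgebraicComplexity.kroneckerPow (Literature.Computability.AlgebraicComplexity.matMulTensor K 2 2 2) β)) - α) / β

/-- **CVZ 2021, Proposition 7** (last item): `i_M(t) ≥ i(t)` (Assumption 1); vendored under the
explicit finiteness hypothesis "some power of `t` restricts MONOMIALLY to `⟨2⟩`" (`Q̃_M(t) > 1`; in
print the remaining cases read `∞ ≥ i(t)`), see the module docstring.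
[cite: ChristandlVranaZuiddam2021, Prop. 7] -/
def CVZ2021_prop7 : Prop :=
  ∀ (K : Type) [Field K] {ι κ μ : Type} [Fintype ι] [Fintype κ] [Fintype μ]
    (t : ι → κ → μ → K), (∀ w u v, t ≠ Literature.Computability.AlgebraicComplexity.triad w u v) →
      (∃ m : ℕ, Literature.Computability.AlgebraicComplexity.TensorMonRestrictsTo (Literature.Computability.AlgebraicComplexity.kroneckerPow t m) (Literature.Computability.AlgebraicComplexity.unitTensor K 2)) →
        Literature.Computability.AlgebraicComplexity.irreversibility t ≤ Literature.Computability.AlgebraicComplexity.monIrreversibility t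

/-- **CVZ 2021, Theorem 13** (monomial irreversibility barrier): for any tensor `t`,
`ω(⟨2⟩, t) · ω_M(t, ⟨2,2,2⟩) ≥ 2 · i_M(t)` — the barrier for approaches whose final step is a
MONOMIAL restriction of powers of `t` to matrix multiplication, e.g. the group-theoretic method
`⟨G⟩ ≥_M ⟨a,b,c⟩` (§4.3). Vendored under the explicit finiteness hypothesis "some power of `t`
restricts monomially to `⟨2,2,2⟩`" (`∃ m, t^{⊗m} ≥_M ⟨2,2,2⟩`): then (monomial restrictions compose and
multiply, and `⟨2,2,2⟩ ≥_M ⟨2⟩`) every set defining `ω_M(t,⟨2,2,2⟩)` and `ω_M(t,⟨2⟩)` is nonempty and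
both are the printed limits; without it the printed right-hand side is `+∞` (vacuous in print) while
the Lean value of `ω_M(t,⟨2,2,2⟩)` is the junk `0` (review of p6795: `t = ⟨2⟩` refutes the
hypothesis-free form). [cite: ChristandlVranaZuiddam2021, Thm. 13] -/
def CVZ2021_thm13 : Prop :=
  ∀ (K : Type) [Field K] {ι κ μ : Type} [Fintype ι] [Fintype κ] [Fintype μ]
    (t : ι → κ → μ → K), (∀ w u v, t ≠ Literature.Computability.AlgebraicComplexity.triad w u v) →
      (∃ m : ℕ, Literature.Computability.AlgebraicComplexity.TensorMonRestrictsTo (Literature.Computability.AlgebraicComplexity.kroneckerPow t m) (Literature.Computability.AlgebraicComplexity.matMulTensor K 2 2 2)) →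
        2 * Literature.Computability.AlgebraicComplexity.monIrreversibility t ≤
          Literature.Computability.AlgebraicComplexity.relativeExponent (Literature.Computability.AlgebraicComplexity.unitTensor K 2) t * Literature.Computability.AlgebraicComplexity.monRelativeExponent t (Literature.Computability.AlgebraicComplexity.matMulTensor K 2 2 2)

/-- **CVZ 2021, Theorem 14**: for any tensor `t` and `α, β ∈ ℕ` (`β > 0`),
`(ω(⟨2⟩,t) · ω_M(t, ⟨2⟩^{⊗α} ⊗ ⟨2,2,2⟩^{⊗β}) − α)/β ≥ 2 i_M(t) + (α/β)(i_M(t) − 1)`; same finiteness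
hypothesis `∃ m, t^{⊗m} ≥_M ⟨2,2,2⟩` as in `CVZ2021_thm13` (for `β ≥ 1` it is equivalent to the
non-emptiness of the sets defining `ω_M(t, ⟨2⟩^{⊗α} ⊗ ⟨2,2,2⟩^{⊗β})`, whose junk value `0` would
otherwise sit on the right-hand side). [cite: ChristandlVranaZuiddam2021, Thm. 14] -/
def CVZ2021_thm14 : Prop :=
  ∀ (K : Type) [Field K] {ι κ μ : Type} [Fintype ι] [Fintype κ] [Fintype μ]
    (t : ι → κ → μ → K), (∀ w u v, t ≠ Literature.Computability.AlgebraicComplexity.triad w u v) →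
      (∃ m : ℕ, Literature.Computability.AlgebraicComplexity.TensorMonRestrictsTo (Literature.Computability.AlgebraicComplexity.kroneckerPow t m) (Literature.Computability.AlgebraicComplexity.matMulTensor K 2 2 2)) → ∀ α β : ℕ, 0 < β →
      2 * Literature.Computability.AlgebraicComplexity.monIrreversibility t + (α / β : ℝ) * (Literature.Computability.AlgebraicComplexity.monIrreversibility t - 1) ≤
        (Literature.Computability.AlgebraicComplexity.relativeExponent (Literature.Computability.AlgebraicComplexity.unitTensor K 2) t *
            Literature.Computability.AlgebraicComplexity.monRelativeExponent t
              (Literature.Computability.AlgebraicComplexity.kroneckerTensor (Literature.Computability.AlgebraicComplexity.kroneckerPow (Literature.Computability.AlgebraicComplexity.unitTensor K 2) α)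
                (Literature.Computability.AlgebraicComplexity.kroneckerPow (Literature.Computability.AlgebraicComplexity.matMulTensor K 2 2 2) β)) - α) / β

/-- **CVZ 2021, §2.2** ("the reader verifies directly"): `ω(⟨2⟩, t) = log₂ R̃(t)` and
`ω(t, ⟨2⟩) = 1 / log₂ Q̃(t)`; hence `i(t) = log₂ R̃(t) / log₂ Q̃(t)` (eq. after Def. 4). `R̃`, `Q̃` are
the tree's `asymptoticRank`, `asymptoticSubrank`. [cite: ChristandlVranaZuiddam2021, §2.2] -/
def CVZ2021_relativeExponent_unit : Prop :=
  ∀ (K : Type) [Field K] {ι κ μ : Type} [Fintype ι] [Fintype κ] [Fintype μ]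
    (t : ι → κ → μ → K), (∀ w u v, t ≠ Literature.Computability.AlgebraicComplexity.triad w u v) →
      Literature.Computability.AlgebraicComplexity.relativeExponent (Literature.Computability.AlgebraicComplexity.unitTensor K 2) t = Real.logb 2 (Literature.Computability.AlgebraicComplexity.asymptoticRank t) ∧
        Literature.Computability.AlgebraicComplexity.relativeExponent t (Literature.Computability.AlgebraicComplexity.unitTensor K 2) = 1 / Real.logb 2 (Literature.Computability.AlgebraicComplexity.asymptoticSubrank K t)

/-- **BCS 1997, Ex. 15.24(4)**: `R̃(⟨2,2,2⟩) = 2^ω` — the identification of CVZ's definition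
`ω := log₂ R̃(⟨2,2,2⟩)` (§2.1) with the exponent `omega K = inf {β | R(⟨n,n,n⟩) = O(n^β)}` of the
tree (Bläser 2013, Def. 5.1). [cite: BurgisserClausenShokrollahi1997, Ex. 15.24(4)] -/
def BCS1997_ex1524_4 : Prop :=
  ∀ (K : Type) [Field K], Literature.Computability.AlgebraicComplexity.asymptoticRank (Literature.Computability.AlgebraicComplexity.matMulTensor K 2 2 2) = (2 : ℝ) ^ Literature.Computability.AlgebraicComplexity.omega K

variable {K : Type} [Field K] {ι κ μ : Type} [Fintype ι] [Fintype κ] [Fintype μ]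

/-- Corollary of Thm. 9 (CVZ §3.1: "if `i(t) > 1`, then `ω(⟨2⟩,t) ω(t,⟨2,2,2⟩) > 2`, i.e. one cannot
prove `ω = 2` via any fixed irreversible intermediate tensor"). [cite: ChristandlVranaZuiddam2021, §3.1] -/
theorem CVZ2021_thm9.two_lt (h9 : CVZ2021_thm9) (t : ι → κ → μ → K)
    (ht : ∀ w u v, t ≠ Literature.Computability.AlgebraicComplexity.triad w u v) (hirr : 1 < Literature.Computability.AlgebraicComplexity.irreversibility t) :
    2 < Literature.Computability.AlgebraicComplexity.relativeExponent (Literature.Computability.AlgebraicComplexity.unitTensor K 2) t * Literature.Computability.AlgebraicComplexity.relativeExponent t (Literature.Computability.AlgebraicComplexity.matMulTensor K 2 2 2) := by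
  have h := h9 K t ht
  linarith

/-- The printed weak form of Thm. 10, `… ≥ 2 i(t)`, from Thm. 10 and Prop. 5 (`i(t) − 1 ≥ 0`).
[cite: ChristandlVranaZuiddam2021, Thm. 10] -/
theorem CVZ2021_thm10.two_irr_le (h10 : CVZ2021_thm10) (h5 : CVZ2021_prop5) (t : ι → κ → μ → K)
    (ht : ∀ w u v, t ≠ Literature.Computability.AlgebraicComplexity.triad w u v)
    (hQ : ∃ m : ℕ, Literature.Computability.AlgebraicComplexity.TensorRestrictsTo (Literature.Computability.AlgebraicComplexity.kroneckerPow t m) (Literature.Computability.AlgebraicComplexity.unitTensor K 2)) (α β : ℕ) (hβ : 0 < β) :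
    2 * Literature.Computability.AlgebraicComplexity.irreversibility t ≤
      (Literature.Computability.AlgebraicComplexity.relativeExponent (Literature.Computability.AlgebraicComplexity.unitTensor K 2) t *
          Literature.Computability.AlgebraicComplexity.relativeExponent t
            (Literature.Computability.AlgebraicComplexity.kroneckerTensor (Literature.Computability.AlgebraicComplexity.kroneckerPow (Literature.Computability.AlgebraicComplexity.unitTensor K 2) α)
              (Literature.Computability.AlgebraicComplexity.kroneckerPow (Literature.Computability.AlgebraicComplexity.matMulTensor K 2 2 2) β)) - α) / β := by
  have h := h10 K t ht α β hβ
  have h1 : 1 ≤ Literature.Computability.AlgebraicComplexity.irreversibility t := h5 K t ht hQ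
  have hnn : 0 ≤ (α / β : ℝ) * (Literature.Computability.AlgebraicComplexity.irreversibility t - 1) :=
    mul_nonneg (by positivity) (by linarith)
  linarith

/-- The first identification of §2.2 in usable form: `ω(⟨2⟩, t) = log₂ R̃(t)` (so an upper bound
on the asymptotic rank of the intermediate tensor is exactly the first factor of the certified
bound). [cite: ChristandlVranaZuiddam2021, §2.2] -/
theorem CVZ2021_relativeExponent_unit.logb_asymptoticRank (h : CVZ2021_relativeExponent_unit)
    (t : ι → κ → μ → K) (ht : ∀ w u v, t ≠ Literature.Computability.AlgebraicComplexity.triad w u v) :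
    Literature.Computability.AlgebraicComplexity.relativeExponent (Literature.Computability.AlgebraicComplexity.unitTensor K 2) t = Real.logb 2 (Literature.Computability.AlgebraicComplexity.asymptoticRank t) :=
  (h K t ht).1

/-- `⟨2,2,2⟩` is not of the form `w ⊗ u ⊗ v` (it satisfies CVZ's Assumption 1): a triad agreeing
with `⟨2,2,2⟩` at the entries `((0,0),(0,0),(0,0))`, `((0,0),(0,0),(1,0))`, `((0,0),(0,1),(1,0))`
would satisfy `1 = w₀₀u₀₀v₀₀`, `0 = w₀₀u₀₀v₁₀`, `1 = w₀₀u₀₁v₁₀`. [folklore] -/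
theorem matMulTensor_two_ne_triad (K : Type) [Field K] (w u v : Fin 2 × Fin 2 → K) :
    Literature.Computability.AlgebraicComplexity.matMulTensor K 2 2 2 ≠ Literature.Computability.AlgebraicComplexity.triad w u v := by
  intro h
  have h1 := congrFun (congrFun (congrFun h (0, 0)) (0, 0)) (0, 0)
  have h2 := congrFun (congrFun (congrFun h (0, 0)) (0, 0)) (1, 0)
  have h3 := congrFun (congrFun (congrFun h (0, 0)) (0, 1)) (1, 0)
  simp only [Literature.Computability.AlgebraicComplexity.matMulTensor, Literature.Computability.AlgebraicComplexity.triad_apply, and_self, if_true, Fin.isValue] at h1 h2 h3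
  norm_num at h1 h2 h3
  rcases h2 with (hw | hu) | hv
  · rw [hw] at h1; simp at h1
  · rw [hu] at h1; simp at h1
  · rw [hv] at h3; simp at h3

/-- **`ω(⟨2⟩, ⟨2,2,2⟩) = ω`** (CVZ §2.2, "by definition of the matrix multiplication exponent",
with CVZ's `ω := log₂ R̃(⟨2,2,2⟩)`), here derived for the tree's `omega K` from the two named facts
`CVZ2021_relativeExponent_unit` and `BCS1997_ex1524_4`. [cite: ChristandlVranaZuiddam2021, §2.2]
[cite: BurgisserClausenShokrollahi1997, Ex. 15.24(4)] -/
theorem relativeExponent_unit_matMul_eq_omega (hU : CVZ2021_relativeExponent_unit)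
    (hB : BCS1997_ex1524_4) (K : Type) [Field K] :
    Literature.Computability.AlgebraicComplexity.relativeExponent (Literature.Computability.AlgebraicComplexity.unitTensor K 2) (Literature.Computability.AlgebraicComplexity.matMulTensor K 2 2 2) = Literature.Computability.AlgebraicComplexity.omega K := by
  rw [(hU K (Literature.Computability.AlgebraicComplexity.matMulTensor K 2 2 2) (matMulTensor_two_ne_triad K)).1, hB K,
    Real.logb_rpow two_pos (by norm_num)]

/-- **The barrier against `ω`.** Under Thm. 9 and the identifications above: for every intermediate
tensor `t` (Assumption 1), `2 i(t) ≤ ω(⟨2⟩,t) · ω(t,⟨2,2,2⟩)`, while (CVZ (3.1), triangle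
inequality) that product is the bound on `ω = ω(⟨2⟩,⟨2,2,2⟩)` the method certifies; so a bound
`ω ≤ ρ` obtained through `t` has `ρ ≥ 2 i(t)`. This lemma records the first inequality with the
method's bound named `ρ`. [cite: ChristandlVranaZuiddam2021, Thm. 9 and §3.1] -/
theorem CVZ2021_thm9.bound_ge (h9 : CVZ2021_thm9) (t : ι → κ → μ → K)
    (ht : ∀ w u v, t ≠ Literature.Computability.AlgebraicComplexity.triad w u v) {ρ : ℝ}
    (hρ : Literature.Computability.AlgebraicComplexity.relativeExponent (Literature.Computability.AlgebraicComplexity.unitTensor K 2) t * Literature.Computability.AlgebraicComplexity.relativeExponent t (Literature.Computability.AlgebraicComplexity.matMulTensor K 2 2 2) ≤ ρ) :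
    2 * Literature.Computability.AlgebraicComplexity.irreversibility t ≤ ρ :=
  (h9 K t ht).trans hρ

end Facts

/-! ## Explicit barriers: small and big Coppersmith–Winograd tensors (CVZ Thm. 19, Thm. 22) -/

section Numerics

/-- **CVZ 2021, Theorem 19** (small Coppersmith–Winograd tensors, over any field): for
`cw_q = Σ_{i=1}^q e_{0,i,i} + e_{i,0,i} + e_{i,i,0}` (`= cwTensor K q`),
`2 i(cw_q) ≥ 2 log₂(q+1) / (log₂ 3 − 2/3 + (2/3) log₂ q)`. Values (Rem. 20 / §1.4): `2` at `q = 2`,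
`2.02..` (`q=3`), `2.06..`, `2.09..`, `2.12..`, `2.15..` (`q=7`). Vendored for `q ≥ 1`.
[cite: ChristandlVranaZuiddam2021, Thm. 19] -/
def CVZ2021_thm19 : Prop :=
  ∀ (K : Type) [Field K] (q : ℕ), 1 ≤ q →
    2 * Real.logb 2 (q + 1) / (Real.logb 2 3 - 2 / 3 + 2 / 3 * Real.logb 2 q) ≤
      2 * Literature.Computability.AlgebraicComplexity.irreversibility (Literature.Computability.AlgebraicComplexity.cwTensor K q)

/-- The average marginal entropy `f_q(x)` of CVZ Thm. 22:
`f_q(x) = −(2/3 − qx) log₂(2/3 − qx) − q · 2x · log₂(2x) − (1/3 − qx) log₂(1/3 − qx)`.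
[cite: ChristandlVranaZuiddam2021, Thm. 22] -/
def cvzEntropy (q : ℕ) (x : ℝ) : ℝ :=
  -((2 / 3 - q * x) * Real.logb 2 (2 / 3 - q * x)) - q * (2 * x) * Real.logb 2 (2 * x) -
    (1 / 3 - q * x) * Real.logb 2 (1 / 3 - q * x)

/-- The maximiser of `f_q` printed in CVZ Thm. 22: `(√33 − 3)/18` for `q = 1`, `1/9` for `q = 2`,
`(3q − √(32 + q²)) / (6(q² − 4))` for `q ≥ 3`. [cite: ChristandlVranaZuiddam2021, Thm. 22] -/
def cvzArgmax (q : ℕ) : ℝ :=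
  if q = 1 then (Real.sqrt 33 - 3) / 18
  else if q = 2 then 1 / 9
  else (3 * q - Real.sqrt (32 + (q : ℝ) ^ 2)) / (6 * ((q : ℝ) ^ 2 - 4))

/-- **CVZ 2021, Theorem 22** (big Coppersmith–Winograd tensors, over any field): for `q ≥ 1`,
`2 i(CW_q) ≥ 2 log₂(q+2) / f_q(x_q)` with `f_q = cvzEntropy q` and `x_q = cvzArgmax q`; numerically
`2.16..` (`q = 1`), `2.17..` (`q = 2`), `2.19..`, `2.20..`, `2.21..`, `2.23..` (`q = 6`); the least
value is `2.16..` at `q = 1` (Rem. 23). [cite: ChristandlVranaZuiddam2021, Thm. 22] -/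
def CVZ2021_thm22 : Prop :=
  ∀ (K : Type) [Field K] (q : ℕ), 1 ≤ q →
    2 * Real.logb 2 (q + 2) / cvzEntropy q (cvzArgmax q) ≤ 2 * Literature.Computability.AlgebraicComplexity.irreversibility (bigCwTensor K q)

/-- Unfolding `cvzArgmax` at `q = 2`. [cite: ChristandlVranaZuiddam2021, Thm. 22] -/
theorem cvzArgmax_two : cvzArgmax 2 = 1 / 9 := by
  simp [cvzArgmax]

/-- `CW_q` is not of the form `w ⊗ u ⊗ v` (Assumption 1 holds for it, every `q`): a triad agreeing
with `CW_q` at `(0,0,q+1)`, `(0,q+1,0)` (entries `1`) and `(0,0,0)` (entry `0`) would satisfy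
`w₀u₀v_{q+1} = 1`, `w₀u_{q+1}v₀ = 1`, `w₀u₀v₀ = 0`. [folklore] -/
theorem bigCwTensor_ne_triad (K : Type) [Field K] (q : ℕ) (w u v : Fin (q + 2) → K) :
    bigCwTensor K q ≠ Literature.Computability.AlgebraicComplexity.triad w u v := by
  intro h
  have hl : (Fin.last (q + 1) : Fin (q + 2)) ≠ 0 := by simp [Fin.ext_iff]
  have h1 := congrFun (congrFun (congrFun h 0) 0) (Fin.last (q + 1))
  have h2 := congrFun (congrFun (congrFun h 0) (Fin.last (q + 1))) 0
  have h3 := congrFun (congrFun (congrFun h 0) 0) 0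
  rw [bigCwTensor_corner, Literature.Computability.AlgebraicComplexity.triad_apply] at h1
  rw [bigCwTensor_zero, Literature.Computability.AlgebraicComplexity.triad_apply] at h3
  simp only [bigCwTensor, Literature.Computability.AlgebraicComplexity.triad_apply, hl, hl.symm, ne_eq, not_false_eq_true, and_true, and_self,
    true_and, and_false, false_and, or_false, false_or, if_true] at h2
  rcases mul_eq_zero.1 h3.symm with h0 | hv
  · rw [h0, zero_mul] at h1; exact one_ne_zero h1
  · rw [hv, mul_zero] at h2; exact one_ne_zero h2

/-- `cw_q` (`q ≥ 1`) is not of the form `w ⊗ u ⊗ v`: entries `(0,1,1) = 1`, `(1,0,1) = 1`,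
`(0,0,1) = 0`. [folklore] -/
theorem cwTensor_ne_triad (K : Type) [Field K] {q : ℕ} (hq : 1 ≤ q) (w u v : Fin (q + 1) → K) :
    Literature.Computability.AlgebraicComplexity.cwTensor K q ≠ Literature.Computability.AlgebraicComplexity.triad w u v := by
  intro h
  have h10 : (1 : Fin (q + 1)) ≠ 0 := by
    simp [Fin.ext_iff, Nat.mod_eq_of_lt (show 1 < q + 1 by omega)]
  have h1 := congrFun (congrFun (congrFun h 0) 1) 1
  have h2 := congrFun (congrFun (congrFun h 1) 0) 1
  have h3 := congrFun (congrFun (congrFun h 0) 0) 1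
  simp only [Literature.Computability.AlgebraicComplexity.cwTensor, Literature.Computability.AlgebraicComplexity.triad_apply, h10, h10.symm, ne_eq, not_false_eq_true, and_true, and_self,
    true_and, and_false, false_and, or_false, false_or, if_true, if_false] at h1 h2 h3
  rcases mul_eq_zero.1 h3.symm with h0 | hv
  · rcases mul_eq_zero.1 h0 with hw | hu
    · rw [hw, zero_mul, zero_mul] at h1; exact one_ne_zero h1
    · rw [hu, mul_zero, zero_mul] at h2; exact one_ne_zero h2
  · rw [hv, mul_zero] at h1; exact one_ne_zero h1

/-- Combining Thm. 22 with Thm. 9: through any fixed `CW_q` (`q ≥ 1`) the certified bound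
`ω(⟨2⟩,CW_q) · ω(CW_q,⟨2,2,2⟩)` is at least `2 log₂(q+2)/f_q(x_q)` (`≥ 2.16..`).
[cite: ChristandlVranaZuiddam2021, Thm. 9 and Thm. 22] -/
theorem CVZ2021_thm22.bigCw_barrier (h22 : CVZ2021_thm22) (h9 : CVZ2021_thm9) (K : Type) [Field K]
    {q : ℕ} (hq : 1 ≤ q) :
    2 * Real.logb 2 (q + 2) / cvzEntropy q (cvzArgmax q) ≤
      Literature.Computability.AlgebraicComplexity.relativeExponent (Literature.Computability.AlgebraicComplexity.unitTensor K 2) (bigCwTensor K q) *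
        Literature.Computability.AlgebraicComplexity.relativeExponent (bigCwTensor K q) (Literature.Computability.AlgebraicComplexity.matMulTensor K 2 2 2) :=
  (h22 K q hq).trans (h9 K (bigCwTensor K q) (bigCwTensor_ne_triad K q))

/-- Combining Thm. 19 with Thm. 9: through any fixed small `cw_q` (`q ≥ 1`) the certified bound is at
least `2 log₂(q+1)/(log₂ 3 − 2/3 + (2/3) log₂ q)` (`= 2` at `q = 2`, `≥ 2.02..` for `q ≥ 3`).
[cite: ChristandlVranaZuiddam2021, Thm. 9 and Thm. 19] -/
theorem CVZ2021_thm19.cw_barrier (h19 : CVZ2021_thm19) (h9 : CVZ2021_thm9) (K : Type) [Field K]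
    {q : ℕ} (hq : 1 ≤ q) :
    2 * Real.logb 2 (q + 1) / (Real.logb 2 3 - 2 / 3 + 2 / 3 * Real.logb 2 q) ≤
      Literature.Computability.AlgebraicComplexity.relativeExponent (Literature.Computability.AlgebraicComplexity.unitTensor K 2) (Literature.Computability.AlgebraicComplexity.cwTensor K q) *
        Literature.Computability.AlgebraicComplexity.relativeExponent (Literature.Computability.AlgebraicComplexity.cwTensor K q) (Literature.Computability.AlgebraicComplexity.matMulTensor K 2 2 2) :=
  (h19 K q hq).trans (h9 K (Literature.Computability.AlgebraicComplexity.cwTensor K q) (cwTensor_ne_triad K hq))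

end Numerics

/-! ## Catalogue entry (D-0021) -/

section Catalogue

/-- **Irreversibility barrier for fast matrix multiplication (Christandl–Vrana–Zuiddam 2021).**
The catalogue entry bundles the general theorem (Thm. 9), its monomial form (Thm. 13) and the
explicit bounds for the small and big Coppersmith–Winograd tensors (Thm. 19, Thm. 22).

BARRIER
technique_class: fixed-intermediate-tensor, restriction, degeneration, laser-method, coppersmith-winograd, universal-method, galactic-method, solar-method, monomial-restriction, asymptotic-rank-of-fixed-tensor
blocks: certifying `MatrixMultiplication` (`ω = 2`), or any bound `ω < 2·i(t)`, by an upper bound obtained through ONE fixed intermediate 3-tensor `t` — an asymptotic-rank (border-rank) bound for `t` composed with asymptotic restrictions of powers of `t` to powers of `⟨2,2,2⟩` (optionally ending with Schönhage's `τ`-theorem, Thm. 10, or with a MONOMIAL restriction as in the group-theoretic method, Thm. 13): the certified bound `ω ≤ ω(⟨2⟩,t)·ω(t,⟨2,2,2⟩)` satisfies `ω(⟨2⟩,t)·ω(t,⟨2,2,2⟩) ≥ 2 i(t) > 2` whenever `i(t) > 1` [cite: ChristandlVranaZuiddam2021, Thm. 9]; this class contains the laser method with merging on `CW_q` barred by Ambainis–Filmus–Le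 Gall and the solar/galactic/universal methods applied to `t` of Alman–Vassilevska Williams (Rem. 12: `ω_g(t) ≥ ω_u(t) ≥ 2 i(t)` for cyclically symmetric `t`) [cite: ChristandlVranaZuiddam2021, §1.5 and Rem. 12] [cite: AmbainisFilmusLeGall2015, §1] [cite: AlmanVassilevskaWilliams2018, §1]; numerically `2 i(CW_q) ≥ 2.16..` for every big Coppersmith–Winograd tensor (`q ≥ 1`) and `2 i(cw_q) ≥ 2.02..` for the small ones with `q ≥ 3` (`CVZ2021_thm22.bigCw_barrier`, `CVZ2021_thm19.cw_barrier`) [cite: ChristandlVranaZuiddam2021, Thm. 19 / Thm. 22 / Rem. 20 / Rem. 23].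
because: relative exponents `ω(t,s) = lim n⁻¹ min{m : t^{⊗m} ≥ s^{⊗n}}` satisfy `ω(t,t) = 1` and the triangle inequality `ω(s,t) ω(t,u) ≥ ω(s,u)` (Prop. 3), and `ω(⟨2,2,2⟩,⟨2⟩) = 1/2` (Strassen, `Q̃(⟨h,h,h⟩) = h²`); hence `ω(⟨2⟩,t) ω(t,⟨2,2,2⟩) ≥ i(t)/ω(⟨2,2,2⟩,⟨2⟩) = 2 i(t)` with `i(t) := ω(⟨2⟩,t) ω(t,⟨2⟩) = log₂ R̃(t)/log₂ Q̃(t) ≥ 1` (Def. 4, Prop. 5); lower bounds on `i(t)` come from flattening ranks (for `R̃`) and Strassen upper support functionals / quantum functionals (for `Q̃`) (Prop. 17, 18) [cite: ChristandlVranaZuiddam2021, §3.1 and §4.1].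
evasions_known: (i) families of intermediate tensors with `i(t_k) → 1` are explicitly not excluded [cite: ChristandlVranaZuiddam2021, §3.1 (after Thm. 9)]; (ii) `cw_2`: the bound of Thm. 19 equals `2` at `q = 2`, and `R̃(cw_2) = 3` (`ω(⟨2⟩,cw_2) = log₂ 3`) would give `ω = 2` [cite: ChristandlVranaZuiddam2021, Rem. 20] [cite: CoppersmithWinograd1990, §11]; (iii) group-algebra tensors `⟨G⟩ ≅ ⊕ ⟨d_i,d_i,d_i⟩` are reversible if `ω = 2`, so plain irreversibility does not rule out `ω = 2` via `⟨G⟩` — only monomial irreversibility (Thm. 13–15) obstructs the group-theoretic route [cite: ChristandlVranaZuiddam2021, §4.3]; (iv) `t = ⟨2,2,2⟩` itself (`2 i(⟨2,2,2⟩) = ω`) is tautologically unobstructed [cite: ChristandlVranaZuiddam2021, §2.3].; (v) further SEMISTABLE small carriers (no certified `i > 1`, see scope caveat (e)), all named in print as still able to give `ω = 2`: the skew cousin `T_skewcw,2 ≅ e₀∧e₁∧e₂` of `cw_2` (`skewCwTensor`, `det3Tensor`, `perm3Tensor` of `BorderRankCW.lean`; `bR(T_skewcw,2) = 5`, `bR(T_skewcw,2^{⊠2})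 = bR(det₃) = 17 < 25`), through which `ω ≤ log_q((4/27)·bR(T_skewcw,q^{⊠k})^{3/k})`, so `R̃(T_skewcw,2) = 3 ⟹ ω = 2` [cite: ConnerGesmundoLandsbergVentura2022, §1.3 and Prop. 3.1] [cite: ConnerHuangLandsberg2020, §1 (p. 3), §1.2 and Thm. 1.2]; `det₃ ≅ T_skewcw,2^{⊠2}` and `perm₃ ≅ cw_2^{⊠2}` ("either `R̃(det₃) = 9` or `R̃(perm₃) = 9` would imply `ω = 2`") [cite: ConnerGesmundoLandsbergVentura2022, Lemma 2.4]; the permanent-type `cw₂′ = Σ_{σ ∈ S₃} x_{σ1} y_{σ2} z_{σ3}` (`R̃(cw₂′) = 3 ⟹ ω = 2`; best known `R(cw₂′) = 4`, characteristic `≠ 2`) [cite: AlmanLi2026, §7.1]; state of these unobstructed lines: `R̃(cw_2) < 3.931 < bR(cw_2) = 4` and `R̃(cw_q) < q + 2 − δ_q` for every `q ≥ 2` ("There is no known barrier like this to using `cw_q`") [cite: AlmanLi2026, §1 and Thm. 1.3], `bR(cw_2^{⊠2}) = 16` (no drop under the Kronecker square) [cite: ConnerHuangLandsberg2020, Thm.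 1.1], `bR(T_skewcw,4^{⊠2}) ≤ 42 < 64 = bR(T_skewcw,4)²` (numerical) [cite: ConnerHuangLandsberg2020, Thm. 1.3]; (vi) RECTANGULAR (or mixed-shape) τ-theorem endings `t^{⊗m} ≥ ⟨2⟩^α ⊗ ⟨a,b,c⟩` through a fixed `t` are barred only by `2·i(cyc t)`, `cyc t := t ⊗ (123)·t ⊗ (123)²·t`, with `i(cyc t) ≤ i(t)` and equality for cyclically symmetric `t` (`CW_q`, `cw_q`) [cite: ChristandlVranaZuiddam2021, Cor. 11 and Rem. 12]; for other carriers the headline "no bound `ω < 2·i(t)` through a fixed `t`" FAILS for such endings: `t = ⟨n,1,n⟩` (`R̃ = n²`, `Q̃ = n`, `i(t) = 2`, `n ≥ 2`) certifies the trivial `ω ≤ 3·log₂ R̃(t)/log₂(n·1·n) = 3 < 4 = 2·i(t)` through `t ≥ t` itself, and `t = ⟨k,k,k²⟩` (`i(t) = ω(1,1,2)/2 ≥ 3/2`, certified by a flattening rank `k³` against the smallest format `k²`) certifies `ω ≤ (3/4)·ω(1,1,2) ≤ (3/4)(ω + 1) < 2.54 < 3 ≤ 2·i(t)` (with `ω <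 2.376`, `CoppersmithWinograd1990_sec8` in the tree); in both cases `cyc t` is a square matrix multiplication tensor and `2·i(cyc t) = ω` obstructs nothing (the vendored Thm. 9 / 10 / 13 / 14 concern SQUARE endings `⟨2,2,2⟩^{⊗n}`, `⟨2⟩^α ⊗ ⟨2,2,2⟩^β`) [cite: ChristandlVranaZuiddam2021, §3.2 (display before Cor. 11) and Cor. 11]
scope_caveats: (a) the technique class is captured only through the certified quantity `ρ ≥ ω(⟨2⟩,t)·ω(t,⟨2,2,2⟩)` (`CVZ2021_thm9.bound_ge`), not by a Lean definition of "method"; that every method in the class certifies exactly this product is the paper's §3.1 (triangle inequality), not formalised [cite: ChristandlVranaZuiddam2021, §3.1]; (b) `ω(t,s)` is formalised as the infimum of the printed limit (Fekete; the paper's "= sup" is a slip) with junk value `0` where print has `+∞`: Prop. 5 / Prop. 7 (junk on the side that must be large, `i(t)`/`i_M(t)`, e.g. `Q̃(t) = 1`) are vendored with the explicit hypothesis `∃ m, t^{⊗m} ≥ ⟨2⟩` (resp. `≥_M`), and Thm. 13 / Thm. 14 (junk on the right-hand side `ω_M(t,⟨2,2,2⟩)`, e.g. `t = ⟨2⟩`)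 with `∃ m, t^{⊗m} ≥_M ⟨2,2,2⟩`; in print all excluded cases are vacuous (`∞ ≥ …`) [cite: ChristandlVranaZuiddam2021, Def. 2 and §2.4 and Assumption 1]; (c) Cor. 11 / Cor. 15 (targets `⟨2⟩^α ⟨a,b,c⟩` via `cyc(t)`), the monomial-DEGENERATION variant of §2.4 and Prop. 16–18 are not vendored; (d) all statements are named facts (not proved here) over arbitrary fields as printed; the identification of CVZ's `ω := log₂ R̃(⟨2,2,2⟩)` with the tree's `omega K` is BCS Ex. 15.24(4) (`BCS1997_ex1524_4`) [cite: BurgisserClausenShokrollahi1997, Ex. 15.24(4)].; (e) EFFECTIVE REACH (audit 2026-08-15): the inequalities are theorems for every `t` (`IrreversibilityBarrier_holds`, `IrreversibilityBarrierAssembly.lean`), but the PLAIN forms (Thm. 9 / 10) OBSTRUCT a line only where `i(t) > 1` is CERTIFIED, and every certificate in print compares a flattening rank ("the best known lower bounds on `R̃(t)` are simply the matrix ranks of the three flattenings") with `min_θ ζ^θ(t)` (Prop. 17; over `ℂ` equivalently `min_θ F^θ(t)` = asymptotic slice rank, Prop. 18, since `F^θ = ζ^θ` for all tensors [cite: SakabeDoganWalter2026,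 Thm. 1.1]) [cite: ChristandlVranaZuiddam2021, §4.1 and Prop. 17]; for a concise `t ∈ ℂ^{N×N×N}` that is `< N` iff `t` is UNSTABLE (`0` in the closure of its `SL×SL×SL`-orbit, iff the uniform point is not in the entanglement polytope) [cite: BlaserLysikov2020, Def. 2, Thm. 3 and §4 (p. 9)], so the certified value of `2·i(t)` is exactly `2` on every SEMISTABLE cubic carrier — in particular on every tensor whose own one-body marginals are uniform (its marginal spectra lie in the polytope): `⟨n,n,n⟩`, `cw_2` ("a semistable `3 × 3 × 3` tensor"), `cw₂′`, `T_skewcw,2 ≅ e₀∧e₁∧e₂`, `det₃`, `perm₃`, group-algebra tables `⟨G⟩`, and on generic tensors — and the plain barrier obstructs no line through them (evasions (ii), (iv), (v)); whether `i(t) > 1` holds there (a spectral point below the quantum functionals, or `Q̃ <` asymptotic slice rank — "we are not aware of any example for which any of the inequalities is strict") is open [cite: ChristandlVranaZuiddam2021, §4.1]; the complementary theorem "unstable concise ⟹ `i(t) ≥ B(n) > 1`" is the sibling entry `UnstableTensorBarrier` [cite: BlaserLysikov2020, Thm. 16], so the tags `laser-method` / `coppersmith-winograd` / `asymptotic-rank-of-fixed-tensor`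 are obstructed here only for unstable carriers (`CW_q`, all `q ≥ 1`; `cw_q`, `q ≥ 3`, whose `min_θ ζ^θ < q + 1` by Thm. 19; `W = cw_1`; truncated polynomial multiplication), not for the semistable ones [cite: AlmanLi2026, §1] [cite: BlaserLysikov2020, §4 (p. 9)]; the MONOMIAL forms (Thm. 13 / 14) are certified differently — by upper bounds on `Q̃_M` in a FIXED basis (tri-coloured sum-free sets, slice rank) — and do bite semistable carriers such as `⟨G⟩` (evasion (iii)) [cite: ChristandlVranaZuiddam2021, §4.3]; for concise NON-cubic formats `N₁, N₂, N₃` square endings are always certified-blocked (`i(t) ≥ log max Nᵢ / log min Nᵢ > 1`, e.g. `⟨k,k,k²⟩`), while rectangular endings go through the cubic `cyc t`, which is unstable iff `t` is (destabilising one-parameter subgroups tensor up, and so do orbit sequences with asymptotically uniform marginals), so taking all endings together a certified obstruction from this entry exists iff the carrier is unstable (evasion (vi)); (f) in the `blocks:` line "optionally ending with Schönhage's τ-theorem" means Thm. 10's SQUARE direct sums `⟨2⟩^α ⊗ ⟨2,2,2⟩^β`; a general ending `⊕ᵢ ⟨aᵢ,bᵢ,cᵢ⟩` reduces (powers and the dominant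 multinomial type) to `⟨2⟩^α ⊗ ⟨a,b,c⟩` and is governed by Cor. 11 (`2·i(cyc t)`), not vendored [cite: ChristandlVranaZuiddam2021, §3.2 and Cor. 11]
status: theorem (established) [cite: ChristandlVranaZuiddam2021, Thm. 9]; the same numerical barriers for `CW_q` were obtained independently with asymptotic slice rank in place of `Q̃` [cite: Alman2021, Thm. 1.3 and §1.3]; audit 2026-08-15: every named fact of this file is proved in the tree (`…Assembly/Thm9/Thm10/Thm13/Thm14/Thm19/Thm22/Prop5/Prop7/Proofs/Ex1524.lean`, axioms `propext`/`Classical.choice`/`Quot.sound`); 2026 context: support functionals = quantum functionals [cite: SakabeDoganWalter2026, Thm. 1.1], first asymptotic-rank drop on an unobstructed carrier `R̃(cw_2) < 3.931` [cite: AlmanLi2026, Thm. 1.3] -/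
def IrreversibilityBarrier : Prop :=
  CVZ2021_thm9 ∧ CVZ2021_thm13 ∧ CVZ2021_thm19 ∧ CVZ2021_thm22

/-- Projection: the general barrier theorem. [cite: ChristandlVranaZuiddam2021, Thm. 9] -/
theorem IrreversibilityBarrier.thm9 (h : IrreversibilityBarrier) : CVZ2021_thm9 := h.1

/-- Projection: the monomial form. [cite: ChristandlVranaZuiddam2021, Thm. 13] -/
theorem IrreversibilityBarrier.thm13 (h : IrreversibilityBarrier) : CVZ2021_thm13 := h.2.1

/-- Projection: the small Coppersmith–Winograd numerics. [cite: ChristandlVranaZuiddam2021, Thm. 19] -/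
theorem IrreversibilityBarrier.thm19 (h : IrreversibilityBarrier) : CVZ2021_thm19 := h.2.2.1

/-- Projection: the big Coppersmith–Winograd numerics. [cite: ChristandlVranaZuiddam2021, Thm. 22] -/
theorem IrreversibilityBarrier.thm22 (h : IrreversibilityBarrier) : CVZ2021_thm22 := h.2.2.2

/-- The catalogue entry in its headline numerical form: through any fixed big Coppersmith–Winograd
tensor `CW_q` (`q ≥ 1`, any field) the certified bound is `≥ 2 log₂(q+2)/f_q(x_q) ≥ 2.16..`.
[cite: ChristandlVranaZuiddam2021, Thm. 22 and Rem. 23] -/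
theorem IrreversibilityBarrier.bigCw (h : IrreversibilityBarrier) (K : Type) [Field K] {q : ℕ}
    (hq : 1 ≤ q) :
    2 * Real.logb 2 (q + 2) / cvzEntropy q (cvzArgmax q) ≤
      Literature.Computability.AlgebraicComplexity.relativeExponent (Literature.Computability.AlgebraicComplexity.unitTensor K 2) (bigCwTensor K q) *
        Literature.Computability.AlgebraicComplexity.relativeExponent (bigCwTensor K q) (Literature.Computability.AlgebraicComplexity.matMulTensor K 2 2 2) :=
  h.thm22.bigCw_barrier h.thm9 K hq

end Catalogue

end Literature.Barriers.MatrixMultiplication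

end
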